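import Mathlib
import HarnessLib
import Summits.HubbardSuperconductivity.HubbardSuperconductivity.Theorems.KLProgrammeKLRegimeEngineLastStepResponseBracketFlow
import Summits.HubbardSuperconductivity.HubbardSuperconductivity.Theorems.KLProgrammeKLRegimeEngineLastStepResponseInputsSharp

/-!
# K3 gen-8-FLOW (stmt 20437, stub (C), located item #20, cure (δ′) «LAST-STEP SWAP», layer F3f, core): THE RESPONSE BRACKET AT THE FLOW FRAMES, SHARP —
# composition step of `lastResponse_bracket_flow_sharp`: as `lastResponse_bracket_flow` with the datum-`1` Bell rows DISCHARGED (`PP_a j := P₄·4^{jm}`, `Za := P₄`) and the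
# tangential constant at its natural size `Zt ≥ 128·ΣGfr·P₄`, `P₄ = 231⁴ + 6·231²·7·10⁵ + 3·(7·10⁵)² + 925·D = 1696963596321 + 925·D`, `D = 10¹⁴(1 + Gfr₃ + Gfr₄)`

Cell gate-hubbard-kl, seat p2 g17.  `…ResponseBracketFlow` (F3d) booked the curve's low jets against the order-4 size `D ≈ 10¹⁴` (so `Zt ∝ D⁴`, and `Zt³` sits in
the threshold).  With `…ResponseInputsSharp` (`lastResponse_tjets_of_pieceJets_sharp`, `datumOne_bellRows_sharp`) the low orders keep `klCurveD1 ≤ 231`,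
`klCurveD2 ≤ 7·10⁵`: `Zt ≥ 128·ΣGfr·P₄` (`≈ 1.2·10¹⁹·ΣGfr·(1+Gfr₃+Gfr₄)`), the `R_a` Bell rows are discharged against `P₄·4^{jm}`, and the smallness reads
`2·Zt·U ≤ 1`, `16·C·U ≤ 1`, `C = 2²⁹·(1/32)·Zt³·P₄ + 2³⁸·Zt²·Zb + 2³³·Zt·Zc + (ZA_a + ZA_b + ZA_c)`.  Remaining hypotheses (asks, by name): `IsUnit` of the two
partition functions; the symbol sups `Dg_X, A₀_X` (order `Mg ≥ 8`; `…LastRespSymbolSups`); the moments of `σ_N[K_N]` and of the odd average (`…LastRespOddMoments`);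
the layer-A rows `AL_X` and the alias Bell rows `AA_X` (curve table explicit); the Bell rows `PP_b, PP_c` and the sizes `Zb, Zc, ZA_X`.

* §1 `flowCurve_table_sharp`, `datumOne_rows_flow`; §2 `lastResponse_bracket_flow_sharp_core` (the composition with the discharged inputs as explicit
  hypotheses — the regime-keyed theorem `lastResponse_bracket_flow_sharp` is `…ResponseBracketFlowSharp`).

Composition only; no definitions; nothing asserts superconductivity.  Refs: BGM 2006 §2.2 (2.23), §2.4 Lemma 2.1 (2.36)–(2.42)
[cite: BenfattoGiulianiMastropietro2006]; FST 1996 §1 [cite: FeldmanSalmhoferTrubowitz1996].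
-/

noncomputable section

namespace Summit.HubbardSuperconductivity.HubbardSuperconductivity.Theorems.EngineV8

set_option linter.dupNamespace false -- summit = problem name (single-conjunct summit), D-0017

open Complex Real Finset Filter Literature.MathematicalPhysics.QuantumLattice Literature.Probability.LatticeModels
open Literature.MathematicalPhysics.QuantumLattice.BandSectorCounting
open Literature.Analysis.Fourier Literature.Analysis.Calculus
open Summit.HubbardSuperconductivity.HubbardSuperconductivity.Theorems.KLRegimeSplit
open Summit.HubbardSuperconductivity.HubbardSuperconductivity.Theorems.DispersionFlow
open Summit.HubbardSuperconductivity.HubbardSuperconductivity.Theorems.KLProgrammeLegKernels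
open Summit.HubbardSuperconductivity.HubbardSuperconductivity.Theorems.PerturbedFermiCurve

/-! ## §1 The flow frame's curve table, sharp, and the datum-`1` rows -/

/-- `1 ≤ D`, `klCurveD1 ≤ 231`, `klCurveD2 ≤ 7·10⁵`, `klCurveD3 A₃ ≤ D·4^m`, `klCurveD4 A₃ A₄ ≤ D·16^m` (`D = 10¹⁴(1 + Gfr₃ + Gfr₄)`). -/
theorem flowCurve_table_sharp {R : RenConsts} (hR : ∀ j, 0 ≤ R.Gfr j) {U : ℝ} (hU0 : 0 ≤ U) (hU1 : U ≤ 1) (m : ℕ) :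
    (1 : ℝ) ≤ (10 ^ 14 * (1 + R.Gfr 3 + R.Gfr 4)) ∧ klCurveD1 ≤ 231 ∧ klCurveD2 ≤ 700000 ∧
    klCurveD3 (R.Gfr 3 * U ^ 2 * ((4 : ℝ) ^ (m + 1) / 3)) ≤ (10 ^ 14 * (1 + R.Gfr 3 + R.Gfr 4)) * (4 : ℝ) ^ m ∧
    klCurveD4 (R.Gfr 3 * U ^ 2 * ((4 : ℝ) ^ (m + 1) / 3)) (R.Gfr 4 * U ^ 2 * ((16 : ℝ) ^ (m + 1) / 15)) ≤ (10 ^ 14 * (1 + R.Gfr 3 + R.Gfr 4)) * ((4 : ℝ) ^ m) ^ 2 := by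
  obtain ⟨h1, -, -, h3, h4⟩ := flowCurve_table_graded hR hU0 hU1 m
  exact ⟨h1, klCurveD1_le, klCurveD2_le, h3, h4⟩

/-- **The datum-`1` Bell rows at the flow frame's curve table, in the bracket's literal shape**, against `PP_a j := P₄·4^{j·n_β}`. -/
theorem datumOne_rows_flow {R : RenConsts} (hR : ∀ j, 0 ≤ R.Gfr j) {U : ℝ} (hU0 : 0 ≤ U) (hU1 : U ≤ 1) (β : ℝ) :
    (fun _ : ℕ => (1 : ℝ)) 0 ≤ (1696963596321 + 925 * (10 ^ 14 * (1 + R.Gfr 3 + R.Gfr 4))) * ((4 : ℝ) ^ nScales β) ^ 0 ∧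
    (fun _ : ℕ => (1 : ℝ)) 1 * klCurveD1 ≤ (1696963596321 + 925 * (10 ^ 14 * (1 + R.Gfr 3 + R.Gfr 4))) * ((4 : ℝ) ^ nScales β) ^ 1 ∧
    (fun _ : ℕ => (1 : ℝ)) 2 * klCurveD1 ^ 2 + (fun _ : ℕ => (1 : ℝ)) 1 * klCurveD2 ≤ (1696963596321 + 925 * (10 ^ 14 * (1 + R.Gfr 3 + R.Gfr 4))) * ((4 : ℝ) ^ nScales β) ^ 2 ∧
    (fun _ : ℕ => (1 : ℝ)) 3 * klCurveD1 ^ 3 + 3 * (fun _ : ℕ => (1 : ℝ)) 2 * klCurveD1 * klCurveD2 + (fun _ : ℕ => (1 : ℝ)) 1 * (klCurveD3 (R.Gfr 3 * U ^ 2 * ((4 : ℝ) ^ (nScales β +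
        1) / 3))) ≤ (1696963596321 + 925 * (10 ^ 14 * (1 + R.Gfr 3 + R.Gfr 4))) * ((4 : ℝ) ^ nScales β) ^ 3 ∧
    (fun _ : ℕ => (1 : ℝ)) 4 * klCurveD1 ^ 4 + 6 * (fun _ : ℕ => (1 : ℝ)) 3 * klCurveD1 ^ 2 * klCurveD2 + 3 * (fun _ : ℕ => (1 : ℝ)) 2 * klCurveD2 ^ 2 +
        4 * (fun _ : ℕ => (1 : ℝ)) 2 * klCurveD1 * (klCurveD3 (R.Gfr 3 * U ^ 2 * ((4 : ℝ) ^ (nScales β + 1) / 3))) + (fun _ : ℕ => (1 : ℝ)) 1 * (klCurveD4 (R.Gfr 3 * U ^ 2 * ((4 : ℝ) ^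
            (nScales β + 1) / 3)) (R.Gfr 4 * U ^ 2 * ((16 : ℝ) ^ (nScales β + 1) / 15))) ≤
      (1696963596321 + 925 * (10 ^ 14 * (1 + R.Gfr 3 + R.Gfr 4))) * ((4 : ℝ) ^ nScales β) ^ 4 := by
  obtain ⟨hD1, hDc1, hDc2, hDc3, hDc4⟩ := flowCurve_table_sharp hR hU0 hU1 (nScales β)
  have hl1 : (1 : ℝ) ≤ ((4 : ℝ) ^ nScales β) := one_le_pow₀ (by norm_num)
  have h3 := hR 3; have h4 := hR 4
  have hA₃0 : 0 ≤ (R.Gfr 3 * U ^ 2 * ((4 : ℝ) ^ (nScales β + 1) / 3)) := by positivity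
  have hA₄0 : 0 ≤ (R.Gfr 4 * U ^ 2 * ((16 : ℝ) ^ (nScales β + 1) / 15)) := by positivity
  obtain ⟨n1, n2, n3, n4⟩ := klCurveD_sizes_nonneg hA₃0 hA₄0
  have hDc0 : ∀ i, 1 ≤ i → i ≤ 4 → 0 ≤ (fun i : ℕ => if i = 1 then klCurveD1 else if i = 2 then klCurveD2 else if i = 3 then klCurveD3 (R.Gfr 3 * U ^ 2 * ((4 : ℝ) ^ (nScales β + 1) /
      3)) else klCurveD4 (R.Gfr 3 * U ^ 2 * ((4 : ℝ) ^ (nScales β + 1) / 3)) (R.Gfr 4 * U ^ 2 * ((16 : ℝ) ^ (nScales β + 1) / 15))) i := by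
    intro i hi1 hi4
    interval_cases i
    · exact n1
    · exact n2
    · exact n3
    · exact n4
  have h := datumOne_bellRows_sharp (Dc := (fun i : ℕ => if i = 1 then klCurveD1 else if i = 2 then klCurveD2 else if i = 3 then klCurveD3 (R.Gfr 3 * U ^ 2 * ((4 : ℝ) ^ (nScales β + 1)
      / 3)) else klCurveD4 (R.Gfr 3 * U ^ 2 * ((4 : ℝ) ^ (nScales β + 1) / 3)) (R.Gfr 4 * U ^ 2 * ((16 : ℝ) ^ (nScales β + 1) / 15)))) hl1 (by norm_num : (1 : ℝ) ≤ 231) (by norm_num :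
      (1 : ℝ) ≤ 700000) hD1 hDc0 hDc1 hDc2 hDc3 hDc4
  have eP : ((231 : ℝ) ^ 4 + 6 * 231 ^ 2 * 700000 + 3 * 700000 ^ 2 + 4 * 231 * (10 ^ 14 * (1 + R.Gfr 3 + R.Gfr 4)) + (10 ^ 14 * (1 + R.Gfr 3 + R.Gfr 4))) = (1696963596321 + 925 * (10 ^
      14 * (1 + R.Gfr 3 + R.Gfr 4))) := by ring
  have h0 := h 0 (by norm_num); have h1 := h 1 (by norm_num); have h2 := h 2 (by norm_num); have h3' := h 3 (by norm_num)
  have h4' := h 4 le_rfl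
  simp only [if_true, if_false, show (1 : ℕ) ≠ 0 by norm_num, show (2 : ℕ) ≠ 0 by norm_num, show (2 : ℕ) ≠ 1 by norm_num,
    show (3 : ℕ) ≠ 0 by norm_num, show (3 : ℕ) ≠ 1 by norm_num, show (3 : ℕ) ≠ 2 by norm_num, show (4 : ℕ) ≠ 0 by norm_num,
    show (4 : ℕ) ≠ 1 by norm_num, show (4 : ℕ) ≠ 2 by norm_num, show (4 : ℕ) ≠ 3 by norm_num, eP] at h0 h1 h2 h3' h4' ⊢
  simp only [one_mul, mul_one]
  exact ⟨h0, h1, h2, h3', h4'⟩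

/-! ## §2 The composition with explicit inputs -/

section FlowSharp

variable {L M : ℕ} [NeZero L] [NeZero M]

/-- The composition step: `lastResponse_bracket_multi` at the flow frames with every discharged input given explicitly (technical; see §3). -/
theorem lastResponse_bracket_flow_sharp_core {R : RenConsts} {β : ℝ} (hβ0 : 0 < β) {U : ℝ} (hU : 0 < U) (μ : ℝ)
    (hZn : IsUnit (effPartitionFn ℂ (normalCovariance L M (uvSymbolCT L M β μ (klFlowFrameU L M β U μ (nScales β + 1)) (klScale klE0 (nScales β + 1))))
      (hubbardInteraction L M β U + counterQuadratic L M β (klFlowFrameU L M β U μ (nScales β + 1)))))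
    (hZo : IsUnit (effPartitionFn ℂ (normalCovariance L M (uvSymbolCT L M β μ (klFlowFrameU L M β U μ (nScales β)) (klScale klE0 (nScales β + 1))))
      (hubbardInteraction L M β U + counterQuadratic L M β (klFlowFrameU L M β U μ (nScales β)))))
    {Zt Zb Zc ZAa ZAb ZAc : ℝ} (hZt0 : 0 ≤ Zt) (hZtU : 2 * Zt * U ≤ 1)
    (hCU : 16 * (2 ^ 29 * (1 / 32) * Zt ^ 3 * (1696963596321 + 925 * (10 ^ 14 * (1 + R.Gfr 3 + R.Gfr 4))) + 2 ^ 38 * Zt ^ 2 * Zb + 2 ^ 33 * Zt * Zc + (ZAa + ZAb + ZAc)) * U ≤ 1)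
    (hγ : ContDiff ℝ 4 (fun θ : ℝ => (WithLp.toLp 2 (klFermiPoint μ (klFlowFrameU L M β U μ (nScales β)) θ) : Momentum))) (hcurve : ∀ θ : ℝ, frameLevel μ (klFlowFrameU L M β U μ
        (nScales β)) ((fun θ : ℝ => (WithLp.toLp 2 (klFermiPoint μ (klFlowFrameU L M β U μ (nScales β)) θ) : Momentum)) θ) = 0)
    (hDc : ∀ θ : ℝ, ∀ i, 1 ≤ i → i ≤ 4 → ‖iteratedDeriv i (fun θ : ℝ => (WithLp.toLp 2 (klFermiPoint μ (klFlowFrameU L M β U μ (nScales β)) θ) : Momentum)) θ‖ ≤ (fun i : ℕ => if i = 1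
        then klCurveD1 else if i = 2 then klCurveD2 else if i = 3 then klCurveD3 (R.Gfr 3 * U ^ 2 * ((4 : ℝ) ^ (nScales β + 1) / 3)) else klCurveD4 (R.Gfr 3 * U ^ 2 * ((4 : ℝ) ^
        (nScales β + 1) / 3)) (R.Gfr 4 * U ^ 2 * ((16 : ℝ) ^ (nScales β + 1) / 15))) i)
    (hω : Real.pi / β ≤ (1 / 32 : ℝ) / ((4 : ℝ) ^ nScales β))
    (ht0 : ∀ θ : ℝ, |(fun θ' : ℝ => evalM (fsub (klFlowFrameU L M β U μ (nScales β + 1)) (klFlowFrameU L M β U μ (nScales β))) ((fun θ : ℝ => (WithLp.toLp 2 (klFermiPoint μ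
        (klFlowFrameU L M β U μ (nScales β)) θ) : Momentum)) θ') / (Real.pi / β)) θ| ≤ Zt * U / ((4 : ℝ) ^ nScales β))
    (htd : ∀ θ : ℝ, ∀ i, 1 ≤ i → i ≤ 4 → |iteratedDeriv i (fun θ' : ℝ => evalM (fsub (klFlowFrameU L M β U μ (nScales β + 1)) (klFlowFrameU L M β U μ (nScales β))) ((fun θ : ℝ =>
        (WithLp.toLp 2 (klFermiPoint μ (klFlowFrameU L M β U μ (nScales β)) θ) : Momentum)) θ') / (Real.pi / β)) θ| ≤ (Zt * U / ((4 : ℝ) ^ nScales β)) * ((4 : ℝ) ^ nScales β) ^ i)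
    (r0 : (fun _ : ℕ => (1 : ℝ)) 0 ≤ (1696963596321 + 925 * (10 ^ 14 * (1 + R.Gfr 3 + R.Gfr 4))) * ((4 : ℝ) ^ nScales β) ^ 0) (r1 : (fun _ : ℕ => (1 : ℝ)) 1 * klCurveD1 ≤
        (1696963596321 + 925 * (10 ^ 14 * (1 + R.Gfr 3 + R.Gfr 4))) * ((4 : ℝ) ^ nScales β) ^ 1)
    (r2 : (fun _ : ℕ => (1 : ℝ)) 2 * klCurveD1 ^ 2 + (fun _ : ℕ => (1 : ℝ)) 1 * klCurveD2 ≤ (1696963596321 + 925 * (10 ^ 14 * (1 + R.Gfr 3 + R.Gfr 4))) * ((4 : ℝ) ^ nScales β) ^ 2)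
    (r3 : (fun _ : ℕ => (1 : ℝ)) 3 * klCurveD1 ^ 3 + 3 * (fun _ : ℕ => (1 : ℝ)) 2 * klCurveD1 * klCurveD2 + (fun _ : ℕ => (1 : ℝ)) 1 * (klCurveD3 (R.Gfr 3 * U ^ 2 * ((4 : ℝ) ^ (nScales
        β + 1) / 3))) ≤ (1696963596321 + 925 * (10 ^ 14 * (1 + R.Gfr 3 + R.Gfr 4))) * ((4 : ℝ) ^ nScales β) ^ 3)
    (r4 : (fun _ : ℕ => (1 : ℝ)) 4 * klCurveD1 ^ 4 + 6 * (fun _ : ℕ => (1 : ℝ)) 3 * klCurveD1 ^ 2 * klCurveD2 + 3 * (fun _ : ℕ => (1 : ℝ)) 2 * klCurveD2 ^ 2 +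
        4 * (fun _ : ℕ => (1 : ℝ)) 2 * klCurveD1 * (klCurveD3 (R.Gfr 3 * U ^ 2 * ((4 : ℝ) ^ (nScales β + 1) / 3))) + (fun _ : ℕ => (1 : ℝ)) 1 * (klCurveD4 (R.Gfr 3 * U ^ 2 * ((4 : ℝ) ^
            (nScales β + 1) / 3)) (R.Gfr 4 * U ^ 2 * ((16 : ℝ) ^ (nScales β + 1) / 15))) ≤
      (1696963596321 + 925 * (10 ^ 14 * (1 + R.Gfr 3 + R.Gfr 4))) * ((4 : ℝ) ^ nScales β) ^ 4)
    {Mg : ℕ} (hMg : 8 ≤ Mg) {s : ℕ}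
    {Dga : ℝ} (hDga : ∀ q, ‖iteratedFDeriv ℝ Mg (fun q : Momentum => ((((evalM (fsub (klFlowFrameU L M β U μ (nScales β)) (klFlowFrameU L M β U μ (nScales β + 1))) q * evalM (fsub
        (klFlowFrameU L M β U μ (nScales β)) (klFlowFrameU L M β U μ (nScales β + 1))) q) / (β * (L : ℝ) ^ 2) : ℝ)) : ℂ) * (((uvWeightFn (klScale klE0 (nScales β + 1)) (matsubaraFreq β
        M (omega0 M)) (frameLevel μ (klFlowFrameU L M β U μ (nScales β)) q) : ℝ) : ℂ) * resolventFnXi (β * (L : ℝ) ^ 2) 0 (matsubaraFreq β M (omega0 M)) (frameLevel μ (klFlowFrameU L M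
        β U μ (nScales β)) q + uvWeightFn (klScale klE0 (nScales β + 1)) (matsubaraFreq β M (omega0 M)) (frameLevel μ (klFlowFrameU L M β U μ (nScales β)) q) * evalM (fsub
        (klFlowFrameU L M β U μ (nScales β)) (klFlowFrameU L M β U μ (nScales β + 1))) q))) q‖ ≤ Dga) {A₀a : ℝ} (hA₀a : ∀ q, ‖(fun q : Momentum => ((((evalM (fsub (klFlowFrameU L M β U
        μ (nScales β)) (klFlowFrameU L M β U μ (nScales β + 1))) q * evalM (fsub (klFlowFrameU L M β U μ (nScales β)) (klFlowFrameU L M β U μ (nScales β + 1))) q) / (β * (L : ℝ) ^ 2) :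
        ℝ)) : ℂ) * (((uvWeightFn (klScale klE0 (nScales β + 1)) (matsubaraFreq β M (omega0 M)) (frameLevel μ (klFlowFrameU L M β U μ (nScales β)) q) : ℝ) : ℂ) * resolventFnXi (β * (L :
        ℝ) ^ 2) 0 (matsubaraFreq β M (omega0 M)) (frameLevel μ (klFlowFrameU L M β U μ (nScales β)) q + uvWeightFn (klScale klE0 (nScales β + 1)) (matsubaraFreq β M (omega0 M))
        (frameLevel μ (klFlowFrameU L M β U μ (nScales β)) q) * evalM (fsub (klFlowFrameU L M β U μ (nScales β)) (klFlowFrameU L M β U μ (nScales β + 1))) q))) q‖ ≤ A₀a)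
    {Dgb : ℝ} (hDgb : ∀ q, ‖iteratedFDeriv ℝ Mg (fun q : Momentum => ((((evalM (fsub (klFlowFrameU L M β U μ (nScales β)) (klFlowFrameU L M β U μ (nScales β + 1))) q / (β * (L : ℝ) ^
        2) : ℝ)) : ℂ) * (((uvWeightFn (klScale klE0 (nScales β + 1)) (matsubaraFreq β M (omega0 M)) (frameLevel μ (klFlowFrameU L M β U μ (nScales β)) q) : ℝ) : ℂ) * resolventFnXi (β *
        (L : ℝ) ^ 2) 0 (matsubaraFreq β M (omega0 M)) (frameLevel μ (klFlowFrameU L M β U μ (nScales β)) q + uvWeightFn (klScale klE0 (nScales β + 1)) (matsubaraFreq β M (omega0 M))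
        (frameLevel μ (klFlowFrameU L M β U μ (nScales β)) q) * evalM (fsub (klFlowFrameU L M β U μ (nScales β)) (klFlowFrameU L M β U μ (nScales β + 1))) q))) * ((((evalM (fsub
        (klFlowFrameU L M β U μ (nScales β)) (klFlowFrameU L M β U μ (nScales β + 1))) q / (β * (L : ℝ) ^ 2) : ℝ)) : ℂ) * (((uvWeightFn (klScale klE0 (nScales β + 1)) (matsubaraFreq β
        M (omega0 M)) (frameLevel μ (klFlowFrameU L M β U μ (nScales β)) q) : ℝ) : ℂ) * resolventFnXi (β * (L : ℝ) ^ 2) 0 (matsubaraFreq β M (omega0 M)) (frameLevel μ (klFlowFrameU L M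
        β U μ (nScales β)) q + uvWeightFn (klScale klE0 (nScales β + 1)) (matsubaraFreq β M (omega0 M)) (frameLevel μ (klFlowFrameU L M β U μ (nScales β)) q) * evalM (fsub
        (klFlowFrameU L M β U μ (nScales β)) (klFlowFrameU L M β U μ (nScales β + 1))) q))) - (2 : ℂ) * ((((evalM (fsub (klFlowFrameU L M β U μ (nScales β)) (klFlowFrameU L M β U μ
        (nScales β + 1))) q / (β * (L : ℝ) ^ 2) : ℝ)) : ℂ) * (((uvWeightFn (klScale klE0 (nScales β + 1)) (matsubaraFreq β M (omega0 M)) (frameLevel μ (klFlowFrameU L M β U μ (nScales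
        β)) q) : ℝ) : ℂ) * resolventFnXi (β * (L : ℝ) ^ 2) 0 (matsubaraFreq β M (omega0 M)) (frameLevel μ (klFlowFrameU L M β U μ (nScales β)) q + uvWeightFn (klScale klE0 (nScales β +
        1)) (matsubaraFreq β M (omega0 M)) (frameLevel μ (klFlowFrameU L M β U μ (nScales β)) q) * evalM (fsub (klFlowFrameU L M β U μ (nScales β)) (klFlowFrameU L M β U μ (nScales β +
        1))) q)))) q‖ ≤ Dgb) {A₀b : ℝ} (hA₀b : ∀ q, ‖(fun q : Momentum => ((((evalM (fsub (klFlowFrameU L M β U μ (nScales β)) (klFlowFrameU L M β U μ (nScales β + 1))) q / (β * (L :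
        ℝ) ^ 2) : ℝ)) : ℂ) * (((uvWeightFn (klScale klE0 (nScales β + 1)) (matsubaraFreq β M (omega0 M)) (frameLevel μ (klFlowFrameU L M β U μ (nScales β)) q) : ℝ) : ℂ) * resolventFnXi
        (β * (L : ℝ) ^ 2) 0 (matsubaraFreq β M (omega0 M)) (frameLevel μ (klFlowFrameU L M β U μ (nScales β)) q + uvWeightFn (klScale klE0 (nScales β + 1)) (matsubaraFreq β M (omega0
        M)) (frameLevel μ (klFlowFrameU L M β U μ (nScales β)) q) * evalM (fsub (klFlowFrameU L M β U μ (nScales β)) (klFlowFrameU L M β U μ (nScales β + 1))) q))) * ((((evalM (fsub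
        (klFlowFrameU L M β U μ (nScales β)) (klFlowFrameU L M β U μ (nScales β + 1))) q / (β * (L : ℝ) ^ 2) : ℝ)) : ℂ) * (((uvWeightFn (klScale klE0 (nScales β + 1)) (matsubaraFreq β
        M (omega0 M)) (frameLevel μ (klFlowFrameU L M β U μ (nScales β)) q) : ℝ) : ℂ) * resolventFnXi (β * (L : ℝ) ^ 2) 0 (matsubaraFreq β M (omega0 M)) (frameLevel μ (klFlowFrameU L M
        β U μ (nScales β)) q + uvWeightFn (klScale klE0 (nScales β + 1)) (matsubaraFreq β M (omega0 M)) (frameLevel μ (klFlowFrameU L M β U μ (nScales β)) q) * evalM (fsub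
        (klFlowFrameU L M β U μ (nScales β)) (klFlowFrameU L M β U μ (nScales β + 1))) q))) - (2 : ℂ) * ((((evalM (fsub (klFlowFrameU L M β U μ (nScales β)) (klFlowFrameU L M β U μ
        (nScales β + 1))) q / (β * (L : ℝ) ^ 2) : ℝ)) : ℂ) * (((uvWeightFn (klScale klE0 (nScales β + 1)) (matsubaraFreq β M (omega0 M)) (frameLevel μ (klFlowFrameU L M β U μ (nScales
        β)) q) : ℝ) : ℂ) * resolventFnXi (β * (L : ℝ) ^ 2) 0 (matsubaraFreq β M (omega0 M)) (frameLevel μ (klFlowFrameU L M β U μ (nScales β)) q + uvWeightFn (klScale klE0 (nScales β +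
        1)) (matsubaraFreq β M (omega0 M)) (frameLevel μ (klFlowFrameU L M β U μ (nScales β)) q) * evalM (fsub (klFlowFrameU L M β U μ (nScales β)) (klFlowFrameU L M β U μ (nScales β +
        1))) q)))) q‖ ≤ A₀b)
    {Mmb : ℕ → ℝ} (hMmb : ∀ m ≤ 4, ∑ x : TorusSite 2 L, (1 + ((x 0).valMinAbs.natAbs : ℝ) + ((x 1).valMinAbs.natAbs : ℝ)) ^ m *
      ‖torusFourierInv (fun k => ((((fun k : TorusSite 2 L => klLocSelfEnergyRe L M β U μ (klFlowFrameU L M β U μ (nScales β + 1)) (nScales β + 1) k) k : ℝ)) : ℂ)) x‖ ≤ Mmb m)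
    {Msb : ℝ} (hMsb : ∑ x : TorusSite 2 L, (1 + ((x 0).valMinAbs.natAbs : ℝ) + ((x 1).valMinAbs.natAbs : ℝ)) ^ s *
      ‖torusFourierInv (fun k => ((((fun k : TorusSite 2 L => klLocSelfEnergyRe L M β U μ (klFlowFrameU L M β U μ (nScales β + 1)) (nScales β + 1) k) k : ℝ)) : ℂ)) x‖ ≤ Msb)
    {Dgc : ℝ} (hDgc : ∀ q, ‖iteratedFDeriv ℝ Mg (fun q : Momentum => -I * (((((evalM (fsub (klFlowFrameU L M β U μ (nScales β)) (klFlowFrameU L M β U μ (nScales β + 1))) q / (β * (L :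
        ℝ) ^ 2) : ℝ)) : ℂ) * (((uvWeightFn (klScale klE0 (nScales β + 1)) (matsubaraFreq β M (omega0 M)) (frameLevel μ (klFlowFrameU L M β U μ (nScales β)) q) : ℝ) : ℂ) * resolventFnXi
        (β * (L : ℝ) ^ 2) 0 (matsubaraFreq β M (omega0 M)) (frameLevel μ (klFlowFrameU L M β U μ (nScales β)) q + uvWeightFn (klScale klE0 (nScales β + 1)) (matsubaraFreq β M (omega0
        M)) (frameLevel μ (klFlowFrameU L M β U μ (nScales β)) q) * evalM (fsub (klFlowFrameU L M β U μ (nScales β)) (klFlowFrameU L M β U μ (nScales β + 1))) q))) * ((((evalM (fsub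
        (klFlowFrameU L M β U μ (nScales β)) (klFlowFrameU L M β U μ (nScales β + 1))) q / (β * (L : ℝ) ^ 2) : ℝ)) : ℂ) * (((uvWeightFn (klScale klE0 (nScales β + 1)) (matsubaraFreq β
        M (omega0 M)) (frameLevel μ (klFlowFrameU L M β U μ (nScales β)) q) : ℝ) : ℂ) * resolventFnXi (β * (L : ℝ) ^ 2) 0 (matsubaraFreq β M (omega0 M)) (frameLevel μ (klFlowFrameU L M
        β U μ (nScales β)) q + uvWeightFn (klScale klE0 (nScales β + 1)) (matsubaraFreq β M (omega0 M)) (frameLevel μ (klFlowFrameU L M β U μ (nScales β)) q) * evalM (fsub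
        (klFlowFrameU L M β U μ (nScales β)) (klFlowFrameU L M β U μ (nScales β + 1))) q))) - (2 : ℂ) * ((((evalM (fsub (klFlowFrameU L M β U μ (nScales β)) (klFlowFrameU L M β U μ
        (nScales β + 1))) q / (β * (L : ℝ) ^ 2) : ℝ)) : ℂ) * (((uvWeightFn (klScale klE0 (nScales β + 1)) (matsubaraFreq β M (omega0 M)) (frameLevel μ (klFlowFrameU L M β U μ (nScales
        β)) q) : ℝ) : ℂ) * resolventFnXi (β * (L : ℝ) ^ 2) 0 (matsubaraFreq β M (omega0 M)) (frameLevel μ (klFlowFrameU L M β U μ (nScales β)) q + uvWeightFn (klScale klE0 (nScales β +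
        1)) (matsubaraFreq β M (omega0 M)) (frameLevel μ (klFlowFrameU L M β U μ (nScales β)) q) * evalM (fsub (klFlowFrameU L M β U μ (nScales β)) (klFlowFrameU L M β U μ (nScales β +
        1))) q))))) q‖ ≤ Dgc) {A₀c : ℝ} (hA₀c : ∀ q, ‖(fun q : Momentum => -I * (((((evalM (fsub (klFlowFrameU L M β U μ (nScales β)) (klFlowFrameU L M β U μ (nScales β + 1))) q / (β *
        (L : ℝ) ^ 2) : ℝ)) : ℂ) * (((uvWeightFn (klScale klE0 (nScales β + 1)) (matsubaraFreq β M (omega0 M)) (frameLevel μ (klFlowFrameU L M β U μ (nScales β)) q) : ℝ) : ℂ) *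
        resolventFnXi (β * (L : ℝ) ^ 2) 0 (matsubaraFreq β M (omega0 M)) (frameLevel μ (klFlowFrameU L M β U μ (nScales β)) q + uvWeightFn (klScale klE0 (nScales β + 1)) (matsubaraFreq
        β M (omega0 M)) (frameLevel μ (klFlowFrameU L M β U μ (nScales β)) q) * evalM (fsub (klFlowFrameU L M β U μ (nScales β)) (klFlowFrameU L M β U μ (nScales β + 1))) q))) *
        ((((evalM (fsub (klFlowFrameU L M β U μ (nScales β)) (klFlowFrameU L M β U μ (nScales β + 1))) q / (β * (L : ℝ) ^ 2) : ℝ)) : ℂ) * (((uvWeightFn (klScale klE0 (nScales β + 1))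
        (matsubaraFreq β M (omega0 M)) (frameLevel μ (klFlowFrameU L M β U μ (nScales β)) q) : ℝ) : ℂ) * resolventFnXi (β * (L : ℝ) ^ 2) 0 (matsubaraFreq β M (omega0 M)) (frameLevel μ
        (klFlowFrameU L M β U μ (nScales β)) q + uvWeightFn (klScale klE0 (nScales β + 1)) (matsubaraFreq β M (omega0 M)) (frameLevel μ (klFlowFrameU L M β U μ (nScales β)) q) * evalM
        (fsub (klFlowFrameU L M β U μ (nScales β)) (klFlowFrameU L M β U μ (nScales β + 1))) q))) - (2 : ℂ) * ((((evalM (fsub (klFlowFrameU L M β U μ (nScales β)) (klFlowFrameU L M β U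
        μ (nScales β + 1))) q / (β * (L : ℝ) ^ 2) : ℝ)) : ℂ) * (((uvWeightFn (klScale klE0 (nScales β + 1)) (matsubaraFreq β M (omega0 M)) (frameLevel μ (klFlowFrameU L M β U μ
        (nScales β)) q) : ℝ) : ℂ) * resolventFnXi (β * (L : ℝ) ^ 2) 0 (matsubaraFreq β M (omega0 M)) (frameLevel μ (klFlowFrameU L M β U μ (nScales β)) q + uvWeightFn (klScale klE0
        (nScales β + 1)) (matsubaraFreq β M (omega0 M)) (frameLevel μ (klFlowFrameU L M β U μ (nScales β)) q) * evalM (fsub (klFlowFrameU L M β U μ (nScales β)) (klFlowFrameU L M β U μ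
        (nScales β + 1))) q))))) q‖ ≤ A₀c)
    {Mmc : ℕ → ℝ} (hMmc : ∀ m ≤ 4, ∑ x : TorusSite 2 L, (1 + ((x 0).valMinAbs.natAbs : ℝ) + ((x 1).valMinAbs.natAbs : ℝ)) ^ m *
      ‖torusFourierInv (fun k => ((((fun k : TorusSite 2 L => (∑ s : Fin 2, ((klSelfEnergy L M β U μ (klFlowFrameU L M β U μ (nScales β + 1)) klE0 (nScales β + 1) (omega0 M, k) s).im -
          (klSelfEnergy L M β U μ (klFlowFrameU L M β U μ (nScales β + 1)) klE0 (nScales β + 1) ((omega0 M).rev, k) s).im)) / 4) k : ℝ)) : ℂ)) x‖ ≤ Mmc m)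
    {Msc : ℝ} (hMsc : ∑ x : TorusSite 2 L, (1 + ((x 0).valMinAbs.natAbs : ℝ) + ((x 1).valMinAbs.natAbs : ℝ)) ^ s *
      ‖torusFourierInv (fun k => ((((fun k : TorusSite 2 L => (∑ s : Fin 2, ((klSelfEnergy L M β U μ (klFlowFrameU L M β U μ (nScales β + 1)) klE0 (nScales β + 1) (omega0 M, k) s).im -
          (klSelfEnergy L M β U μ (klFlowFrameU L M β U μ (nScales β + 1)) klE0 (nScales β + 1) ((omega0 M).rev, k) s).im)) / 4) k : ℝ)) : ℂ)) x‖ ≤ Msc)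
    {ALa : ℕ → ℝ}
    (hALa : ∀ j ≤ 4, 2 * (2 * (1 * ((3 : ℝ) ^ j * Dga * (2 / ((2 * (L / 4 + 1) : ℕ) : ℝ)) ^ (Mg - j - 4) *
        (2 ^ 2 * ∑' k : Fin 2 → ℤ, ∏ i, (1 + (k i : ℝ) ^ 2)⁻¹)))) + (L : ℝ) ^ 2 * (L : ℝ) ^ j * (A₀a * (1 / (1 + (L : ℝ) / 4) ^ s)) ≤ ALa j)
    {AAa : ℕ → ℝ} (hAAa0 : ALa 0 ≤ AAa 0) (hAAa1 : ALa 1 * klCurveD1 ≤ AAa 1) (hAAa2 : ALa 2 * klCurveD1 ^ 2 + ALa 1 * klCurveD2 ≤ AAa 2)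
    (hAAa3 : ALa 3 * klCurveD1 ^ 3 + 3 * ALa 2 * klCurveD1 * klCurveD2 + ALa 1 * (klCurveD3 (R.Gfr 3 * U ^ 2 * ((4 : ℝ) ^ (nScales β + 1) / 3))) ≤ AAa 3)
    (hAAa4 : ALa 4 * klCurveD1 ^ 4 + 6 * ALa 3 * klCurveD1 ^ 2 * klCurveD2 + 3 * ALa 2 * klCurveD2 ^ 2 + 4 * ALa 2 * klCurveD1 * (klCurveD3 (R.Gfr 3 * U ^ 2 * ((4 : ℝ) ^ (nScales β +
        1) / 3))) + ALa 1 * (klCurveD4 (R.Gfr 3 * U ^ 2 * ((4 : ℝ) ^ (nScales β + 1) / 3)) (R.Gfr 4 * U ^ 2 * ((16 : ℝ) ^ (nScales β + 1) / 15))) ≤ AAa 4)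
    {ALb : ℕ → ℝ}
    (hALb : ∀ j ≤ 4, 2 * (2 * (Mmb j * ((3 : ℝ) ^ j * Dgb * (2 / ((2 * (L / 4 + 1) : ℕ) : ℝ)) ^ (Mg - j - 4) *
        (2 ^ 2 * ∑' k : Fin 2 → ℤ, ∏ i, (1 + (k i : ℝ) ^ 2)⁻¹)))) + (L : ℝ) ^ 2 * (L : ℝ) ^ j * (A₀b * (Msb / (1 + (L : ℝ) / 4) ^ s)) ≤ ALb j)
    {PPb : ℕ → ℝ} (hPPb0 : Mmb 0 ≤ PPb 0) (hPPb1 : Mmb 1 * klCurveD1 ≤ PPb 1) (hPPb2 : Mmb 2 * klCurveD1 ^ 2 + Mmb 1 * klCurveD2 ≤ PPb 2)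
    (hPPb3 : Mmb 3 * klCurveD1 ^ 3 + 3 * Mmb 2 * klCurveD1 * klCurveD2 + Mmb 1 * (klCurveD3 (R.Gfr 3 * U ^ 2 * ((4 : ℝ) ^ (nScales β + 1) / 3))) ≤ PPb 3)
    (hPPb4 : Mmb 4 * klCurveD1 ^ 4 + 6 * Mmb 3 * klCurveD1 ^ 2 * klCurveD2 + 3 * Mmb 2 * klCurveD2 ^ 2 + 4 * Mmb 2 * klCurveD1 * (klCurveD3 (R.Gfr 3 * U ^ 2 * ((4 : ℝ) ^ (nScales β +
        1) / 3))) + Mmb 1 * (klCurveD4 (R.Gfr 3 * U ^ 2 * ((4 : ℝ) ^ (nScales β + 1) / 3)) (R.Gfr 4 * U ^ 2 * ((16 : ℝ) ^ (nScales β + 1) / 15))) ≤ PPb 4)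
    {AAb : ℕ → ℝ} (hAAb0 : ALb 0 ≤ AAb 0) (hAAb1 : ALb 1 * klCurveD1 ≤ AAb 1) (hAAb2 : ALb 2 * klCurveD1 ^ 2 + ALb 1 * klCurveD2 ≤ AAb 2)
    (hAAb3 : ALb 3 * klCurveD1 ^ 3 + 3 * ALb 2 * klCurveD1 * klCurveD2 + ALb 1 * (klCurveD3 (R.Gfr 3 * U ^ 2 * ((4 : ℝ) ^ (nScales β + 1) / 3))) ≤ AAb 3)
    (hAAb4 : ALb 4 * klCurveD1 ^ 4 + 6 * ALb 3 * klCurveD1 ^ 2 * klCurveD2 + 3 * ALb 2 * klCurveD2 ^ 2 + 4 * ALb 2 * klCurveD1 * (klCurveD3 (R.Gfr 3 * U ^ 2 * ((4 : ℝ) ^ (nScales β +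
        1) / 3))) + ALb 1 * (klCurveD4 (R.Gfr 3 * U ^ 2 * ((4 : ℝ) ^ (nScales β + 1) / 3)) (R.Gfr 4 * U ^ 2 * ((16 : ℝ) ^ (nScales β + 1) / 15))) ≤ AAb 4)
    {ALc : ℕ → ℝ}
    (hALc : ∀ j ≤ 4, 2 * (2 * (Mmc j * ((3 : ℝ) ^ j * Dgc * (2 / ((2 * (L / 4 + 1) : ℕ) : ℝ)) ^ (Mg - j - 4) *
        (2 ^ 2 * ∑' k : Fin 2 → ℤ, ∏ i, (1 + (k i : ℝ) ^ 2)⁻¹)))) + (L : ℝ) ^ 2 * (L : ℝ) ^ j * (A₀c * (Msc / (1 + (L : ℝ) / 4) ^ s)) ≤ ALc j)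
    {PPc : ℕ → ℝ} (hPPc0 : Mmc 0 ≤ PPc 0) (hPPc1 : Mmc 1 * klCurveD1 ≤ PPc 1) (hPPc2 : Mmc 2 * klCurveD1 ^ 2 + Mmc 1 * klCurveD2 ≤ PPc 2)
    (hPPc3 : Mmc 3 * klCurveD1 ^ 3 + 3 * Mmc 2 * klCurveD1 * klCurveD2 + Mmc 1 * (klCurveD3 (R.Gfr 3 * U ^ 2 * ((4 : ℝ) ^ (nScales β + 1) / 3))) ≤ PPc 3)
    (hPPc4 : Mmc 4 * klCurveD1 ^ 4 + 6 * Mmc 3 * klCurveD1 ^ 2 * klCurveD2 + 3 * Mmc 2 * klCurveD2 ^ 2 + 4 * Mmc 2 * klCurveD1 * (klCurveD3 (R.Gfr 3 * U ^ 2 * ((4 : ℝ) ^ (nScales β +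
        1) / 3))) + Mmc 1 * (klCurveD4 (R.Gfr 3 * U ^ 2 * ((4 : ℝ) ^ (nScales β + 1) / 3)) (R.Gfr 4 * U ^ 2 * ((16 : ℝ) ^ (nScales β + 1) / 15))) ≤ PPc 4)
    {AAc : ℕ → ℝ} (hAAc0 : ALc 0 ≤ AAc 0) (hAAc1 : ALc 1 * klCurveD1 ≤ AAc 1) (hAAc2 : ALc 2 * klCurveD1 ^ 2 + ALc 1 * klCurveD2 ≤ AAc 2)
    (hAAc3 : ALc 3 * klCurveD1 ^ 3 + 3 * ALc 2 * klCurveD1 * klCurveD2 + ALc 1 * (klCurveD3 (R.Gfr 3 * U ^ 2 * ((4 : ℝ) ^ (nScales β + 1) / 3))) ≤ AAc 3)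
    (hAAc4 : ALc 4 * klCurveD1 ^ 4 + 6 * ALc 3 * klCurveD1 ^ 2 * klCurveD2 + 3 * ALc 2 * klCurveD2 ^ 2 + 4 * ALc 2 * klCurveD1 * (klCurveD3 (R.Gfr 3 * U ^ 2 * ((4 : ℝ) ^ (nScales β +
        1) / 3))) + ALc 1 * (klCurveD4 (R.Gfr 3 * U ^ 2 * ((4 : ℝ) ^ (nScales β + 1) / 3)) (R.Gfr 4 * U ^ 2 * ((16 : ℝ) ^ (nScales β + 1) / 15))) ≤ AAc 4)
    (hPPbs : ∀ j ≤ 4, PPb j ≤ Zb * U * ((4 : ℝ) ^ nScales β) ^ j)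
    (hPPcs : ∀ j ≤ 4, PPc j ≤ Zc * U ^ 2 * ((4 : ℝ) ^ nScales β) ^ j / ((4 : ℝ) ^ nScales β))
    (hAAas : ∀ k ≤ 4, AAa k ≤ ZAa * U ^ 3 * ((4 : ℝ) ^ nScales β) ^ k / ((4 : ℝ) ^ nScales β) ^ 2) (hAAbs : ∀ k ≤ 4, AAb k ≤ ZAb * U ^ 3 * ((4 : ℝ) ^ nScales β) ^ k / ((4 : ℝ) ^ nScales β) ^ 2)
    (hAAcs : ∀ k ≤ 4, AAc k ≤ ZAc * U ^ 3 * ((4 : ℝ) ^ nScales β) ^ k / ((4 : ℝ) ^ nScales β) ^ 2) :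
    ContDiff ℝ 4 (fun θ : ℝ => (symInterp L (fun k => klLocSelfEnergyRe L M β U μ (klFlowFrameU L M β U μ (nScales β + 1)) (nScales β + 1) k -
            (klFlowFrameU L M β U μ (nScales β + 1)).eval (latticeMomentum L k))).eval (klFermiPoint μ (klFlowFrameU L M β U μ (nScales β)) θ) -
        (symInterp L (fun k => klLocSelfEnergyRe L M β U μ (klFlowFrameU L M β U μ (nScales β)) (nScales β + 1) k -
            (klFlowFrameU L M β U μ (nScales β)).eval (latticeMomentum L k))).eval (klFermiPoint μ (klFlowFrameU L M β U μ (nScales β)) θ)) ∧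
    ∀ k ≤ 4, ∀ θ : ℝ, |iteratedDeriv k (fun θ : ℝ => (symInterp L (fun k => klLocSelfEnergyRe L M β U μ (klFlowFrameU L M β U μ (nScales β + 1)) (nScales β + 1) k -
            (klFlowFrameU L M β U μ (nScales β + 1)).eval (latticeMomentum L k))).eval (klFermiPoint μ (klFlowFrameU L M β U μ (nScales β)) θ) -
        (symInterp L (fun k => klLocSelfEnergyRe L M β U μ (klFlowFrameU L M β U μ (nScales β)) (nScales β + 1) k -
            (klFlowFrameU L M β U μ (nScales β)).eval (latticeMomentum L k))).eval (klFermiPoint μ (klFlowFrameU L M β U μ (nScales β)) θ)) θ| ≤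
      curveJetBar (fun k => if k = 0 then 0 else 1) (fun k => if k = 0 then 1 else 0) U k (nScales β + 1) := by
  exact lastResponse_bracket_multi (L := L) (M := M) (Mma := fun _ : ℕ => (1 : ℝ)) (Msa := (1 : ℝ)) (PPa := fun j : ℕ => (1696963596321 + 925 * (10 ^ 14 * (1 + R.Gfr 3 + R.Gfr 4))) *
      ((4 : ℝ) ^ nScales β) ^ j)
    hβ0 hU μ (klFlowFrameU L M β U μ (nScales β)) (klFlowFrameU L M β U μ (nScales β + 1)) (Nat.lt_succ_self _) hZn hZo hγ hcurve hDc (nScales β) hZt0 hZtU hCU hω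
    ht0 htd hMg hDga hA₀a (fun m _ => (moments_datum_one (L := L) m).le) (moments_datum_one (L := L) s).le hDgb hA₀b hMmb hMsb hDgc hA₀c hMmc hMsc
    hALa r0 r1 r2 r3 r4 hAAa0 hAAa1 hAAa2 hAAa3 hAAa4
    hALb hPPb0 hPPb1 hPPb2 hPPb3 hPPb4 hAAb0 hAAb1 hAAb2 hAAb3 hAAb4
    hALc hPPc0 hPPc1 hPPc2 hPPc3 hPPc4 hAAc0 hAAc1 hAAc2 hAAc3 hAAc4 (fun j _ => le_rfl) hPPbs hPPcs hAAas hAAbs hAAcs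

end FlowSharp

end Summit.HubbardSuperconductivity.HubbardSuperconductivity.Theorems.EngineV8

end
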